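import Summits.PneNP.PneNP.Theorems.ConvexRankGatesConvexGateBlindCanonical

set_option linter.dupNamespace false

/-!
# PneNP / ConvexRankGates — `ConvexGateBlind`, ε-free ("strict rank") form

Helpers (`--supports stmt-PneNP-10680`), continuing `ConvexRankGatesConvexGateBlindCanonical.lean`
(`convexGateBlind_iff_canonical`: the crux ⟺ for every `ε > 0` the explicit matrix
`D_m - εJ`, `D_m[u, Q] = #(E(Q) ∖ u)`, has no polynomial `PSD_q × ℝ^r_{≥0}` factorisation). Here
the limit `ε → 0⁺` is traded for ONE existential object, following Hrubeš's strict rank `rk₊₊`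
(ECCC TR19-034 / Comput. Complexity 2020, §3.3, Lemma 16: `rk₊₊(M) - 1 ≤ min_{ε>0} rk₊(M - εJ) ≤
rk₊₊(M) + 1`) adapted to the mixed cone `PSD × ℝ_{≥0}` and to a single positive term:
* `strict_of_canonical` / `canonical_of_strict` — a factorisation of `D_m - εJ` (`ε > 0`) of size
  `(q, r)` is a decomposition `D_m = tr(H_u Y_Q) + ∑_ℓ λ s + b(u) a(Q)` with ONE STRICTLY POSITIVE
  rank-one term (`b ≡ ε`, `a ≡ 1`), and conversely such a decomposition of size `(q, r)` gives a
  factorisation of `D_m - εJ` of size `(q, r + 2)` with `ε = (min b)(min a) > 0`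
  (`b a - ε = b (a - min a) + (b - min b) min a`);
* `convexGateBlind_iff_strict` — hence **the crux is EQUIVALENT to**: for some `δ ∈ (0, 1/2)` and
  every `c`, eventually in `m`, `D_m` (rows: `⌈m^δ⌉₊`-clique-free graphs, columns: `⌈m^δ⌉₊`-sets)
  has NO decomposition `tr(H_u Y_Q) + ∑_{ℓ<r} λ_{u,ℓ} s_{Q,ℓ} + b(u) a(Q)` with `H_u, Y_Q ⪰ 0`
  (`q × q`), `λ, s ≥ 0`, `b, a > 0`, `q + r ≤ m^c`. No `ε` and no limit remain; the adversary must
  commit to a positive rank-one minorant `b ⊗ a ≤ D_m` (the "potential" of crux idea card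
  strict-rank-conic-cover), and `D_m` itself (all terms merely non-negative) decomposes with
  `q = 0`, `r = #E` (`canonical_factorisation_eps_zero`).
[folklore; Hrubeš 2020, Lemma 16, Open Problem 4]
-/

namespace Summit.PneNP.PneNP.Theorems

open Matrix Finset Filter Literature.Computability.Complexity

/-! ### The ε-free ("strict") form -/

/-- **Strict ⇒ canonical.** If `#(E(Q) ∖ u) = tr(H_u Y_Q) + ∑_ℓ λ_{u,ℓ} s_{Q,ℓ} + b(u)·a(Q)` with the
cone data as before and ONE STRICTLY POSITIVE rank-one term (`b > 0` on the clique-free graphs,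
`a > 0` on the `k`-sets), then for `ε = (min b)(min a) > 0` the canonical matrix
`#(E(Q) ∖ u) - ε` factorises through `PSD_q × ℝ^{r+2}_{≥0}`:
`b a - ε = b (a - min a) + (b - min b)(min a)`. [folklore; Hrubeš 2020, Lemma 16] -/
theorem canonical_of_strict {m k q r : ℕ}
    (H : ((⊤ : SimpleGraph (Fin m)).edgeSet → Bool) → Matrix (Fin q) (Fin q) ℝ)
    (lam : ((⊤ : SimpleGraph (Fin m)).edgeSet → Bool) → Fin r → ℝ)
    (Y : Finset (Fin m) → Matrix (Fin q) (Fin q) ℝ) (s : Finset (Fin m) → Fin r → ℝ)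
    (b : ((⊤ : SimpleGraph (Fin m)).edgeSet → Bool) → ℝ) (a : Finset (Fin m) → ℝ)
    (hlam : ∀ u, cliqueFn m k u = false → ∀ ℓ, 0 ≤ lam u ℓ)
    (hs : ∀ Q : Finset (Fin m), Q.card = k → ∀ ℓ, 0 ≤ s Q ℓ)
    (hb : ∀ u, cliqueFn m k u = false → 0 < b u)
    (ha : ∀ Q : Finset (Fin m), Q.card = k → 0 < a Q)
    (hid : ∀ (Q : Finset (Fin m)) (u : (⊤ : SimpleGraph (Fin m)).edgeSet → Bool),
      Q.card = k → cliqueFn m k u = false →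
        ∑ e, (if u e then (0 : ℝ) else 1) * (if cliqueVec Q e then (1 : ℝ) else 0) =
          (H u * Y Q).trace + ∑ ℓ, lam u ℓ * s Q ℓ + b u * a Q) :
    ∃ ε : ℝ, 0 < ε ∧
      ∃ (lam' : ((⊤ : SimpleGraph (Fin m)).edgeSet → Bool) → Fin (r + 2) → ℝ)
        (s' : Finset (Fin m) → Fin (r + 2) → ℝ),
        (∀ u, cliqueFn m k u = false → ∀ ℓ, 0 ≤ lam' u ℓ) ∧
        (∀ Q : Finset (Fin m), Q.card = k → ∀ ℓ, 0 ≤ s' Q ℓ) ∧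
        ∀ (Q : Finset (Fin m)) (u : (⊤ : SimpleGraph (Fin m)).edgeSet → Bool),
          Q.card = k → cliqueFn m k u = false →
            ∑ e, (if u e then (0 : ℝ) else 1) * (if cliqueVec Q e then (1 : ℝ) else 0) - ε =
              (H u * Y Q).trace + ∑ ℓ, lam' u ℓ * s' Q ℓ := by
  classical
  -- the two minima (over finite index sets; default value 1 off the relevant rows/columns)
  set fb : (((⊤ : SimpleGraph (Fin m)).edgeSet → Bool)) → ℝ :=
    fun u => if cliqueFn m k u = false then b u else 1 with hfb
  set fa : Finset (Fin m) → ℝ := fun Q => if Q.card = k then a Q else 1 with hfa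
  have hneb : (Finset.univ : Finset ((⊤ : SimpleGraph (Fin m)).edgeSet → Bool)).Nonempty :=
    Finset.univ_nonempty
  have hnea : (Finset.univ : Finset (Finset (Fin m))).Nonempty := Finset.univ_nonempty
  set bmin : ℝ := Finset.univ.inf' hneb fb with hbmin
  set amin : ℝ := Finset.univ.inf' hnea fa with hamin
  have hbmin_pos : 0 < bmin := by
    rw [hbmin, Finset.lt_inf'_iff]
    intro u _
    simp only [hfb]
    split_ifs with hu
    · exact hb u hu
    · exact one_pos
  have hamin_pos : 0 < amin := by
    rw [hamin, Finset.lt_inf'_iff]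
    intro Q _
    simp only [hfa]
    split_ifs with hQ
    · exact ha Q hQ
    · exact one_pos
  have hbmin_le : ∀ u, cliqueFn m k u = false → bmin ≤ b u := by
    intro u hu
    have hfu : fb u = b u := by simp [hfb, hu]
    exact (Finset.inf'_le fb (Finset.mem_univ u)).trans hfu.le
  have hamin_le : ∀ Q : Finset (Fin m), Q.card = k → amin ≤ a Q := by
    intro Q hQ
    have hfQ : fa Q = a Q := by simp [hfa, hQ]
    exact (Finset.inf'_le fa (Finset.mem_univ Q)).trans hfQ.le
  -- new factors on `Fin r ⊕ Bool`, enumerated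
  let L := Fin r ⊕ Bool
  let lamL : (((⊤ : SimpleGraph (Fin m)).edgeSet → Bool)) → L → ℝ := fun u =>
    Sum.elim (fun ℓ => lam u ℓ) (fun bb => cond bb (b u) (b u - bmin))
  let sL : Finset (Fin m) → L → ℝ := fun Q =>
    Sum.elim (fun ℓ => s Q ℓ) (fun bb => cond bb (a Q - amin) amin)
  have hcardL : Fintype.card L = r + 2 := by
    simp only [L, Fintype.card_sum, Fintype.card_fin, Fintype.card_bool]
  let eL : L ≃ Fin (r + 2) := (Fintype.equivFin L).trans (finCongr hcardL)
  have hrow : ∀ u, cliqueFn m k u = false → ∀ i : Fin (r + 2), 0 ≤ lamL u (eL.symm i) := by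
    intro u hu i
    generalize eL.symm i = l
    rcases l with (ℓ | bb)
    · exact hlam u hu ℓ
    · cases bb
      · exact sub_nonneg.2 (hbmin_le u hu)
      · exact (hb u hu).le
  have hcol : ∀ Q : Finset (Fin m), Q.card = k → ∀ i : Fin (r + 2), 0 ≤ sL Q (eL.symm i) := by
    intro Q hQ i
    generalize eL.symm i = l
    rcases l with (ℓ | bb)
    · exact hs Q hQ ℓ
    · cases bb
      · exact hamin_pos.le
      · exact sub_nonneg.2 (hamin_le Q hQ)
  refine ⟨bmin * amin, mul_pos hbmin_pos hamin_pos, fun u i => lamL u (eL.symm i),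
    fun Q i => sL Q (eL.symm i), hrow, hcol, ?_⟩
  intro Q u hQ hu
  have hsum : ∑ i, lamL u (eL.symm i) * sL Q (eL.symm i) = ∑ l, lamL u l * sL Q l :=
    Equiv.sum_comp eL.symm (fun l => lamL u l * sL Q l)
  rw [hsum]
  simp only [L, lamL, sL, Fintype.sum_sum_type, Sum.elim_inl, Sum.elim_inr, Fintype.sum_bool,
    Bool.cond_true, Bool.cond_false]
  rw [hid Q u hQ hu]
  ring

/-- **Canonical ⇒ strict.** A factorisation of `#(E(Q) ∖ u) - ε` (`ε > 0`) is a strict one of the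
same size with the positive rank-one term `ε · 1`. [folklore] -/
theorem strict_of_canonical {m k q r : ℕ} {ε : ℝ} (hε : 0 < ε)
    (H : ((⊤ : SimpleGraph (Fin m)).edgeSet → Bool) → Matrix (Fin q) (Fin q) ℝ)
    (lam : ((⊤ : SimpleGraph (Fin m)).edgeSet → Bool) → Fin r → ℝ)
    (Y : Finset (Fin m) → Matrix (Fin q) (Fin q) ℝ) (s : Finset (Fin m) → Fin r → ℝ)
    (hid : ∀ (Q : Finset (Fin m)) (u : (⊤ : SimpleGraph (Fin m)).edgeSet → Bool),
      Q.card = k → cliqueFn m k u = false →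
        ∑ e, (if u e then (0 : ℝ) else 1) * (if cliqueVec Q e then (1 : ℝ) else 0) - ε =
          (H u * Y Q).trace + ∑ ℓ, lam u ℓ * s Q ℓ) :
    ∃ (b : ((⊤ : SimpleGraph (Fin m)).edgeSet → Bool) → ℝ) (a : Finset (Fin m) → ℝ),
      (∀ u, cliqueFn m k u = false → 0 < b u) ∧ (∀ Q : Finset (Fin m), Q.card = k → 0 < a Q) ∧
      ∀ (Q : Finset (Fin m)) (u : (⊤ : SimpleGraph (Fin m)).edgeSet → Bool),
        Q.card = k → cliqueFn m k u = false →
          ∑ e, (if u e then (0 : ℝ) else 1) * (if cliqueVec Q e then (1 : ℝ) else 0) =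
            (H u * Y Q).trace + ∑ ℓ, lam u ℓ * s Q ℓ + b u * a Q :=
  ⟨fun _ => ε, fun _ => 1, fun _ _ => hε, fun _ _ => one_pos, fun Q u hQ hu => by
    rw [← hid Q u hQ hu]; ring⟩

/-- Size bookkeeping: `m^c + 2 ≤ m^(c+2)` for `m ≥ 2`. [folklore] -/
theorem pow_add_two_le {m c : ℕ} (hm : 2 ≤ m) : m ^ c + 2 ≤ m ^ (c + 2) := by
  have h1 : 1 ≤ m ^ c := Nat.one_le_pow _ _ (by omega)
  have h4 : 4 ≤ m ^ 2 := by
    calc 4 = 2 ^ 2 := by norm_num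
      _ ≤ m ^ 2 := Nat.pow_le_pow_left hm 2
  calc m ^ c + 2 ≤ 4 * m ^ c := by omega
    _ ≤ m ^ 2 * m ^ c := Nat.mul_le_mul_right _ h4
    _ = m ^ (c + 2) := by ring

/-- **`ConvexGateBlind`, ε-free strict form.** The crux is EQUIVALENT to: for some `δ ∈ (0, 1/2)`
and every `c`, eventually in `m`, the explicit matrix `D_m[u, Q] = #(E(Q) ∖ u)` (rows: the
`⌈m^δ⌉₊`-clique-free graphs, columns: the `⌈m^δ⌉₊`-sets) has NO decomposition
`D_m[u, Q] = tr(H_u Y_Q) + ∑_{ℓ<r} λ_{u,ℓ} s_{Q,ℓ} + b(u) a(Q)` with `H_u, Y_Q ⪰ 0` (`q × q`),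
`λ, s ≥ 0`, `q + r ≤ m^c`, and ONE STRICTLY POSITIVE rank-one term (`b > 0`, `a > 0`). No limit and
no `ε` remain: the adversary must commit to one positive rank-one minorant `b ⊗ a ≤ D_m` (a
"potential"), after which `D_m - b ⊗ a` has genuine zeros — the form in which support-sensitive
lower-bound technology can re-enter (crux idea card strict-rank-conic-cover, Lever; Hrubeš's
strict non-negative rank `rk₊₊`, here for the cone `PSD × ℝ_{≥0}`). (`→`: `canonical_of_strict`,
sizes `m^c ↦ m^c + 2 ≤ m^(c+2)`; `←`: `strict_of_canonical`.) [folklore; Hrubeš 2020, Lemma 16] -/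
theorem convexGateBlind_iff_strict :
    Summit.PneNP.PneNP.Theses.ConvexRankGates.ConvexGateBlind ↔
    (∃ δ : ℝ, 0 < δ ∧ δ < 1 / 2 ∧ ∀ c : ℕ, ∀ᶠ m : ℕ in Filter.atTop,
      ∀ (q r : ℕ), q + r ≤ m ^ c →
        ∀ (H : ((⊤ : SimpleGraph (Fin m)).edgeSet → Bool) → Matrix (Fin q) (Fin q) ℝ)
          (lam : ((⊤ : SimpleGraph (Fin m)).edgeSet → Bool) → Fin r → ℝ)
          (Y : Finset (Fin m) → Matrix (Fin q) (Fin q) ℝ) (s : Finset (Fin m) → Fin r → ℝ)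
          (b : ((⊤ : SimpleGraph (Fin m)).edgeSet → Bool) → ℝ) (a : Finset (Fin m) → ℝ),
          (∀ u, cliqueFn m ⌈(m : ℝ) ^ δ⌉₊ u = false → (H u).PosSemidef) →
          (∀ u, cliqueFn m ⌈(m : ℝ) ^ δ⌉₊ u = false → ∀ ℓ, 0 ≤ lam u ℓ) →
          (∀ Q : Finset (Fin m), Q.card = ⌈(m : ℝ) ^ δ⌉₊ → (Y Q).PosSemidef) →
          (∀ Q : Finset (Fin m), Q.card = ⌈(m : ℝ) ^ δ⌉₊ → ∀ ℓ, 0 ≤ s Q ℓ) →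
          (∀ u, cliqueFn m ⌈(m : ℝ) ^ δ⌉₊ u = false → 0 < b u) →
          (∀ Q : Finset (Fin m), Q.card = ⌈(m : ℝ) ^ δ⌉₊ → 0 < a Q) →
          ¬ ∀ (Q : Finset (Fin m)) (u : (⊤ : SimpleGraph (Fin m)).edgeSet → Bool),
              Q.card = ⌈(m : ℝ) ^ δ⌉₊ → cliqueFn m ⌈(m : ℝ) ^ δ⌉₊ u = false →
                ∑ e, (if u e then (0 : ℝ) else 1) * (if cliqueVec Q e then (1 : ℝ) else 0) =
                  (H u * Y Q).trace + ∑ ℓ, lam u ℓ * s Q ℓ + b u * a Q) := by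
  rw [convexGateBlind_iff_canonical]
  constructor
  · rintro ⟨δ, hδ0, hδ1, h⟩
    refine ⟨δ, hδ0, hδ1, fun c => ?_⟩
    filter_upwards [h (c + 2), eventually_ge_atTop 2] with m hm h2
    intro q r hqr H lam Y s b a hH hlam hY hs hb ha hid
    obtain ⟨ε, hε, lam', s', hlam', hs', hid'⟩ :=
      canonical_of_strict H lam Y s b a hlam hs hb ha hid
    exact hm ε hε q (r + 2) (by have := pow_add_two_le (c := c) h2; omega) H lam' Y s' hH hlam'
      hY hs' hid'
  · rintro ⟨δ, hδ0, hδ1, h⟩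
    refine ⟨δ, hδ0, hδ1, fun c => ?_⟩
    filter_upwards [h c] with m hm
    intro ε hε q r hqr H lam Y s hH hlam hY hs hid
    obtain ⟨b, a, hb, ha, hid'⟩ := strict_of_canonical hε H lam Y s hid
    exact hm q r hqr H lam Y s b a hH hlam hY hs hb ha hid'

end Summit.PneNP.PneNP.Theorems
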